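import Summits.AtomisticToContinuum.FouriersLaw.Theorems.HonestZwanzigFeshbachIdentitiesLaplacePositivity
import Summits.AtomisticToContinuum.FouriersLaw.Theorems.OddSectorIrreversibilityOddDensityIsCorrectorDetailedBalance
import Summits.AtomisticToContinuum.FouriersLaw.Theorems.OddSectorIrreversibilityOddDensityIsCorrectorAdjoint
import Summits.AtomisticToContinuum.FouriersLaw.Theorems.JunctionLocalitySuperadditiveResistanceStubDeviceForwardFieldsAux3
import Summits.AtomisticToContinuum.FouriersLaw.Theorems.JunctionLocalitySuperadditiveResistanceKuboResolvent
import Summits.AtomisticToContinuum.FouriersLaw.Theorems.JunctionLocalitySuperadditiveResistancePlainAdjoint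
import Summits.AtomisticToContinuum.FouriersLaw.Theorems.OddSectorIrreversibilityCorrectorTheoryExistence
import Summits.AtomisticToContinuum.FouriersLaw.Theorems.OddSectorIrreversibilityCorrectorTheorySmooth

/-!
# Line `series-law-at-every-laplace-frequency` (crux `LatticeLandauDamping.AbelThermodynamicLimit`,
stmt-AtomisticToContinuum-14013; `Iff.rfl`-shared with stmt-AtomisticToContinuum-12596) — helper toward the
sign-law stubs `stub_quasiSuperadditivity` (QS) / `stub_quasiSuperadditiveResistance` (QSR):
**the resolvent corrector package at Laplace frequency `ν > 0`**

Both sign laws of the line are statements about the current resolvent form of the OPEN chain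
`F_N(ν) = ∫₀^∞ e^{-νt} ∫ J · (P_t J) dμ_{N,T} dt` (`P = pinnedChain ω₂ lam β γ`, both Langevin baths at `T`,
`J = Σ_i bondCurrent N i`, `P_t = transitionKernel N T T t` the constructed kernels, `μ_{N,T} = gibbsMeasure N T`),
and every proof idea on record for them ("junction surgery of the accretive `Θ`-reversible resolvent") starts from
the same fixed-`N` dictionary between `F_N(ν)` and the CORRECTOR `u_ν = (ν − L_N)⁻¹ J`. This file proves that
dictionary, unconditionally, by assembling landed tree theorems (`stub_resolventCorrectorPackage`): for all parameters
`> 0`, `T > 0`, `N ≥ 2`, `ν > 0` there is a SMOOTH `u ∈ L²(μ_{N,T})` with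

* `ν u − L_N u = J` pointwise (`L_N = OscillatorChain.generator N T T`);
* `u = R_ν J := ∫_{(0,∞)} e^{-νt} P_t J dt` `μ_{N,T}`-a.e. (the semigroup resolvent of the constructed kernels);
* `F_N(ν) = ⟨J, u⟩_{μ_{N,T}}` (the line's `F` VERBATIM on the left);
* the storage–dissipation identity `⟨J, u⟩ = ν‖u‖² + γT(‖∂_{p_0}u‖² + ‖∂_{p_{N−1}}u‖²)` (all norms in `L²(μ_{N,T})`).

Proof: `F_N(ν) = ⟨J, R_νJ⟩` is `HonestZwanzig.pinnedChain_lap_eq_integral_mul_resolvent` with `μ_T(J) = 0`; the weak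
equation `∫ (−X_Hφ + γS φ − νφ) R_νJ dμ_T = −∫ Jφ dμ_T` (`φ ∈ C_c^∞`) is
`OddSectorIrreversibility.pinnedChain_resolvent_adjoint_test` (detailed balance `R_ν* = ΘR_νΘ` and Dynkin) read through
`generator_comp_reversal` (`L† = ΘLΘ = −X_H + γS`); hypoelliptic regularity
`FloatingProbeBypassLaplacian.exists_classical_of_weak_gibbs` makes `R_νJ` a.e. a smooth classical solution; the energy
identity is `SuperadditiveResistance.Kubo.resolvent_fd`. No definitions, no named facts; standard axioms.
References: Kundu–Dhar–Narayan 2009 (reln1)–(reln3); Cuneo–Eckmann–Hairer–Rey-Bellet 2018 Thm 2.13;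
Bernardin–Olla 2011 §6 (the accretive resolvent calculus this is the first line of).
-/

noncomputable section

open MeasureTheory ProbabilityTheory Filter Topology Set Function
open scoped ContDiff NNReal ENNReal
open Literature.MathematicalPhysics.KineticTheory.HeatConduction
open Summit.AtomisticToContinuum.FouriersLaw.Theorems.SubdiffusiveBondHeat
open Summit.AtomisticToContinuum.FouriersLaw.Theorems.OddSectorIrreversibility
open Summit.AtomisticToContinuum.FouriersLaw.Theorems.OddSectorIrreversibility.Corrector
open Summit.AtomisticToContinuum.FouriersLaw.Theorems.HonestZwanzig
open Summit.AtomisticToContinuum.FouriersLaw.Theorems.SuperadditiveResistance.DeviceLiouville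
open Summit.AtomisticToContinuum.FouriersLaw.Theorems.SuperadditiveResistance.Kubo
open Summit.AtomisticToContinuum.FouriersLaw.Cruxes.SuperadditiveResistance.FloatingProbeBypassLaplacian

namespace Summit.AtomisticToContinuum.FouriersLaw.Theorems.AbelThermodynamicLimit.SeriesLawAtEveryLaplaceFrequency

/-- **Resolvent corrector package at `ν > 0`** (helper toward `stub_quasiSuperadditivity` /
`stub_quasiSuperadditiveResistance` of line series-law-at-every-laplace-frequency). For `P = pinnedChain ω₂ lam β γ`
(all `> 0`), `T > 0`, `N ≥ 2`, `ν > 0`, `J = Σ_i bondCurrent N i`: there is a smooth `u ∈ L²(μ_{N,T})` with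
`ν u − L_N u = J` pointwise, `u = ∫_{(0,∞)} e^{-νt} P_t J dt` a.e., `F_N(ν) = ∫ J u dμ_{N,T}` and
`∫ J u dμ = ν ∫ u² dμ + γ T (∫ (∂_{p_0}u)² dμ + ∫ (∂_{p_{N−1}}u)² dμ)`. [folklore] -/
theorem stub_resolventCorrectorPackage :
    ∀ ω₂ lam β γ : ℝ, 0 < ω₂ → 0 < lam → 0 < β → 0 < γ → ∀ T : ℝ, 0 < T → ∀ N : ℕ, 2 ≤ N → ∀ ν : ℝ, 0 < ν →
    ∃ u : Literature.MathematicalPhysics.KineticTheory.HeatConduction.PhaseSpace N → ℝ,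
      ContDiff ℝ ((⊤ : ℕ∞) : WithTop ℕ∞) u ∧
      MeasureTheory.MemLp u 2 ((Literature.MathematicalPhysics.KineticTheory.HeatConduction.pinnedChain ω₂ lam β γ).gibbsMeasure N T) ∧
      (∀ x, ν * u x - (Literature.MathematicalPhysics.KineticTheory.HeatConduction.pinnedChain ω₂ lam β γ).generator N T T u x =
        ∑ i : Fin N, (Literature.MathematicalPhysics.KineticTheory.HeatConduction.pinnedChain ω₂ lam β γ).bondCurrent N i x) ∧
      (u =ᵐ[(Literature.MathematicalPhysics.KineticTheory.HeatConduction.pinnedChain ω₂ lam β γ).gibbsMeasure N T] fun z =>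
        ∫ t in Set.Ioi (0:ℝ), Real.exp (-(ν * t)) *
          ∫ y, (∑ i : Fin N, (Literature.MathematicalPhysics.KineticTheory.HeatConduction.pinnedChain ω₂ lam β γ).bondCurrent N i y)
            ∂((Literature.MathematicalPhysics.KineticTheory.HeatConduction.pinnedChain ω₂ lam β γ).transitionKernel N T T t.toNNReal z)) ∧
      MeasureTheory.integral (MeasureTheory.volume.restrict (Set.Ioi (0:ℝ))) (fun t : ℝ =>
        Real.exp (-(ν * t)) *
          ∫ z, (∑ i : Fin N, (Literature.MathematicalPhysics.KineticTheory.HeatConduction.pinnedChain ω₂ lam β γ).bondCurrent N i z) *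
            (∫ y, (∑ i : Fin N, (Literature.MathematicalPhysics.KineticTheory.HeatConduction.pinnedChain ω₂ lam β γ).bondCurrent N i y) ∂((Literature.MathematicalPhysics.KineticTheory.HeatConduction.pinnedChain ω₂ lam β γ).transitionKernel N T T t.toNNReal z))
            ∂((Literature.MathematicalPhysics.KineticTheory.HeatConduction.pinnedChain ω₂ lam β γ).gibbsMeasure N T)) =
        ∫ z, (∑ i : Fin N, (Literature.MathematicalPhysics.KineticTheory.HeatConduction.pinnedChain ω₂ lam β γ).bondCurrent N i z) * u z
          ∂((Literature.MathematicalPhysics.KineticTheory.HeatConduction.pinnedChain ω₂ lam β γ).gibbsMeasure N T) ∧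
      ∀ b₀ b₁ : Fin N, b₀.val = 0 → b₁.val = N - 1 →
        ∫ z, (∑ i : Fin N, (Literature.MathematicalPhysics.KineticTheory.HeatConduction.pinnedChain ω₂ lam β γ).bondCurrent N i z) * u z
            ∂((Literature.MathematicalPhysics.KineticTheory.HeatConduction.pinnedChain ω₂ lam β γ).gibbsMeasure N T) =
          ν * ∫ z, u z ^ 2 ∂((Literature.MathematicalPhysics.KineticTheory.HeatConduction.pinnedChain ω₂ lam β γ).gibbsMeasure N T) +
            γ * T * ((∫ z, (Literature.MathematicalPhysics.KineticTheory.HeatConduction.partialP b₀ u z) ^ 2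
                ∂((Literature.MathematicalPhysics.KineticTheory.HeatConduction.pinnedChain ω₂ lam β γ).gibbsMeasure N T)) +
              ∫ z, (Literature.MathematicalPhysics.KineticTheory.HeatConduction.partialP b₁ u z) ^ 2
                ∂((Literature.MathematicalPhysics.KineticTheory.HeatConduction.pinnedChain ω₂ lam β γ).gibbsMeasure N T)) := by
  intro ω₂ lam β γ hω hl hβ hγ T hT N hN ν hν
  set P := pinnedChain ω₂ lam β γ with hP
  set μ := P.gibbsMeasure N T with hμ
  set J : PhaseSpace N → ℝ := fun z => ∑ i : Fin N, P.bondCurrent N i z with hJ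
  set ustar : PhaseSpace N → ℝ := fun z => ∫ t in Ioi (0:ℝ), Real.exp (-(ν * t)) *
    ∫ y, J y ∂(P.transitionKernel N T T t.toNNReal z) with hustar
  have hN0 : 0 < N := by omega
  have hl0 : 0 ≤ lam := hl.le
  haveI : IsProbabilityMeasure μ := pinnedChain_isProbabilityMeasure_gibbsMeasure hω hl0 hβ.le γ N hT
  -- the exponential class `ϑ = 1/(4T)`
  set ϑ : ℝ := 1 / (4 * T) with hϑ
  have hϑ0 : 0 < ϑ := by positivity
  have h2ϑ : 2 * ϑ < 1 / T := by
    have e : 2 * ϑ = 1 / (2 * T) := by rw [hϑ]; field_simp; ring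
    rw [e]
    exact one_div_lt_one_div_of_lt hT (by linarith)
  -- the total current: continuous, smooth, of exponential class, odd, centred, square integrable
  have hJc : Continuous J := continuous_totalBondCurrent ω₂ lam β γ N
  have hJs : ContDiff ℝ ∞ J := contDiff_totalBondCurrent ω₂ lam β γ N
  obtain ⟨M, hM0, hJb⟩ := abs_totalBondCurrent_le_exp hω.le hl0 hβ.le γ N hϑ0
  have hJmean : ∫ y, J y ∂μ = 0 := integral_totalBondCurrent_gibbsMeasure ω₂ lam β γ N T
  have hJ2 : Integrable (fun y => J y ^ 2) μ := pinnedChain_integrable_sq_nice hω hl0 hβ hT h2ϑ hJc hJb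
  have hJmem : MemLp J 2 μ := (memLp_two_iff_integrable_sq hJc.aestronglyMeasurable).2 hJ2
  -- the semigroup resolvent `R_ν J`: measurable and square integrable
  have hUm : StronglyMeasurable ustar :=
    pinnedChain_stronglyMeasurable_resolvent hω hl0 hβ.le hγ.le T T hJc.measurable ν
  have hU2 := (pinnedChain_integral_sq_resolvent_le hω hl0 hβ hγ hN0 hT hϑ0 h2ϑ hJc hM0 hJb hν).1
  have hUmem : MemLp ustar 2 μ := (memLp_two_iff_integrable_sq hUm.aestronglyMeasurable).2 hU2
  have hUint : Integrable ustar μ := hUmem.integrable one_le_two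
  -- the weak resolvent equation, tested against the `μ_T`-adjoint `−X_H + γS − ν`
  have hweak : ∀ φ : PhaseSpace N → ℝ, ContDiff ℝ ∞ φ → HasCompactSupport φ →
      ∫ x, (-(1:ℝ) * liouvilleOp P N φ x + γ * bathOp N (OscillatorChain.bathWeight N) T φ x + (-ν) * φ x) *
          ustar x ∂μ = ∫ x, (-J x) * φ x ∂μ := by
    intro φ hφ hφc
    have h := pinnedChain_resolvent_adjoint_test hω hl0 hβ hγ hN hT hϑ0 h2ϑ hφ hφc hJc hM0 hJb hν
    -- `(L(φ∘Θ))(Θx) = −X_H φ x + γ S φ x`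
    have hrev : ∀ x : PhaseSpace N,
        P.generator N T T (fun y : PhaseSpace N => φ (y.1, -y.2)) (x.1, -x.2) =
          -liouvilleOp P N φ x + γ * bathOp N (OscillatorChain.bathWeight N) T φ x := by
      intro x
      have e := generator_eq_liouvilleOp_add P N T (rev φ) (x.1, -x.2)
      rw [liouvilleOp_rev, bathOp_rev] at e
      simp only [neg_neg, Prod.mk.eta] at e
      have hγP : P.γ = γ := by simp [hP, pinnedChain]
      rw [hγP] at e
      exact e
    have e1 : (fun x => (-(1:ℝ) * liouvilleOp P N φ x + γ * bathOp N (OscillatorChain.bathWeight N) T φ x +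
        (-ν) * φ x) * ustar x) =
        fun x => -((ν * φ x - P.generator N T T (fun y : PhaseSpace N => φ (y.1, -y.2)) (x.1, -x.2)) * ustar x) := by
      funext x
      rw [hrev x]
      ring
    rw [e1, integral_neg, h, ← integral_neg]
    exact integral_congr_ae (Eventually.of_forall fun x => by ring)
  -- hypoelliptic regularity: `R_ν J` is a.e. a smooth classical solution of `(X_H + γS − ν) u = −J`
  have hB : ∀ i : Fin N, 0 ≤ OscillatorChain.bathWeight N i := fun i => by
    unfold OscillatorChain.bathWeight; split_ifs <;> norm_num
  have hB0 : 0 < OscillatorChain.bathWeight N ⟨0, hN0⟩ := by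
    unfold OscillatorChain.bathWeight; simp only [if_true]; split_ifs <;> norm_num
  obtain ⟨u, huC, hae, hpde⟩ := exists_classical_of_weak_gibbs hω hl0 hβ.le γ hN0 hT one_ne_zero hγ hB hB0 (-ν)
    hUint hJs.neg hweak
  have hu2 : MemLp u 2 μ := hUmem.ae_eq hae
  -- the PDE in generator form
  have hgen : ∀ x, ν * u x - P.generator N T T u x = J x := fun x => by
    have e := hpde x
    rw [generator_eq_liouvilleOp_add]
    simp only [hP, pinnedChain] at e ⊢
    linarith
  -- `F_N(ν) = ⟨J, R_ν J⟩ = ⟨J, u⟩`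
  have hlap := pinnedChain_lap_eq_integral_mul_resolvent hω hl0 hβ hγ hN0 hT hϑ0 h2ϑ hJc hJc hM0 hM0 hJb hJb hν
  have hF : ∫ t in Ioi (0:ℝ), Real.exp (-(ν * t)) *
      ∫ z, J z * (∫ y, J y ∂(P.transitionKernel N T T t.toNNReal z)) ∂μ = ∫ z, J z * u z ∂μ := by
    have e1 : (fun t : ℝ => Real.exp (-(ν * t)) *
        ((∫ z, J z * (∫ y, J y ∂(P.transitionKernel N T T t.toNNReal z)) ∂μ) - (∫ z, J z ∂μ) * (∫ z, J z ∂μ))) =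
        fun t : ℝ => Real.exp (-(ν * t)) * ∫ z, J z * (∫ y, J y ∂(P.transitionKernel N T T t.toNNReal z)) ∂μ := by
      funext t; rw [hJmean]; ring
    rw [e1, hJmean] at hlap
    rw [hlap]
    simp only [zero_mul, zero_div, sub_zero]
    exact integral_congr_ae (hae.mono fun z hz => by show J z * ustar z = J z * u z; rw [hz])
  -- the storage–dissipation identity
  have hpair : ∀ x, (1:ℝ) * liouvilleOp P N u x + γ * bathOp N (OscillatorChain.bathWeight N) T u x = -(J x - ν * u x) := by
    intro x; have e := hpde x; linarith
  have hfd := resolvent_fd hω hl0 hβ.le N hT (OscillatorChain.bathWeight N) hB 1 hγ ν (huC.of_le (by norm_cast)) hu2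
    hJmem hpair
  have henergy : ∀ b₀ b₁ : Fin N, b₀.val = 0 → b₁.val = N - 1 →
      ∫ z, J z * u z ∂μ = ν * ∫ z, u z ^ 2 ∂μ +
        γ * T * ((∫ z, (partialP b₀ u z) ^ 2 ∂μ) + ∫ z, (partialP b₁ u z) ^ 2 ∂μ) := by
    intro b₀ b₁ hb₀ hb₁
    have hsum : ∀ g : Fin N → ℝ, ∑ i, OscillatorChain.bathWeight N i * g i = g b₀ + g b₁ := by
      intro g
      have e := sum_ite_ends_eq hN g
      have e0 : (⟨0, by omega⟩ : Fin N) = b₀ := Fin.ext (by simp [hb₀])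
      have e1 : (⟨N - 1, by omega⟩ : Fin N) = b₁ := Fin.ext (by simp [hb₁])
      rw [e0, e1] at e
      rw [← e]
      refine Finset.sum_congr rfl fun i _ => ?_
      unfold OscillatorChain.bathWeight
      split_ifs <;> ring
    rw [hsum] at hfd
    -- pass from `ρ dx` to `μ_T = Z⁻¹ ρ dx`
    rw [P.integral_gibbsMeasure, P.integral_gibbsMeasure (fun z => u z ^ 2), P.integral_gibbsMeasure,
      P.integral_gibbsMeasure (fun z => partialP b₁ u z ^ 2)]
    have e2 : (fun x => J x * u x * P.gibbsDensity N T x) = fun x => u x * J x * P.gibbsDensity N T x := by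
      funext x; ring
    rw [e2, hfd]
    ring
  exact ⟨u, huC, hu2, hgen, hae.symm, hF, henergy⟩

end Summit.AtomisticToContinuum.FouriersLaw.Theorems.AbelThermodynamicLimit.SeriesLawAtEveryLaplaceFrequency

end
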